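import Mathlib
import HarnessLib

/-!
# A probabilistic container bound: i.i.d. samples avoiding a measurable relation
(crux `DiffuseBackwardInfluence`, stmt-AtomisticToContinuum-12950, line `share-nondegeneracy-one-flight`; support file of
the lead's stub `stub_stickLD`, registered sub-goal `pi_setOf_pairwise_not_adj_le`)

The stub `stub_stickLD` asks for a SUPER-exponential bound on the probability that `k ≍ ηN` INDEPENDENT random sticks
(uniform position × Maxwellian velocity, thickness `ε_N`, duration `τ_N`) are pairwise non-crossing. Every decoupling
of that event (sequential conditioning, Janson, bounded differences, test-particle splits) loses to an `e^{-O(k)}`-cheap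
conspiracy of the part whose own non-crossing was dropped; the method that keeps the constraint on ALL pairs is the
Kleitman–Winston / Balogh–Morris–Samotij–Saxton–Thomason CONTAINER method. This file proves its measure-theoretic
form for i.i.d. samples, with no geometry in it:

**Theorem (`pi_setOf_pairwise_not_adj_le`).** Let `ν` be a probability measure on `Ω`, `Adj` a relation on `Ω` whose
graph is a measurable subset of `Ω × Ω`, and `0 < d < ∞`, `0 < ρ₀`. SUPERSATURATION: every measurable `S` with
`ν S ≥ ρ₀` has `∫_S ν({z' | Adj z z'} ∩ S) dν(z) ≥ 2 d · ν S`. Then for every `k` and every `f : ℕ` with `d⁻¹ ≤ f`, the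
`ν^{⊗k}`-measure of the configurations `Z : Fin k → Ω` with `¬ Adj (Z i) (Z j)` for all `i ≠ j` is at most
`∑_{t ≤ f} (k choose t) ρ₀^{k - t}`.

Proof (§2–§4). For a finite index set `I` put `C_I(Z) := {z | ∀ i ∈ I, ¬ Adj (Z i) z}` and the CONTAINER
`cont_I(Z) := {z ∈ C_I(Z) | ν(shadow z ∩ C_I(Z)) < d}`. (Cover, §3) If `Z` is pairwise non-adjacent, an index set
`I` of maximum size among those with `ν(C_I) + |I| d ≤ 1` has `|I| ≤ d⁻¹ ≤ f` and every `Z j`, `j ∉ I`, in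
`cont_I(Z)` (it lies in `C_I` by non-adjacency, and had it `ν`-degree `≥ d` into `C_I`, `I ∪ {j}` would still satisfy
the budget). (Small containers, §2) `cont_I(Z)` has all internal degrees `< d`, so supersaturation forces
`ν(cont_I(Z)) < ρ₀`. (Count, §4) `cont_I(Z)` depends on `Z` only through `Z|_I`; splitting `ν^{⊗k}` along `I`
(`measurePreserving_piEquivPiSubtypeProd`, `Measure.prod_apply`, `Measure.pi_pi`) the event "all `Z j`, `j ∉ I`, lie
in `cont_I`" has measure `≤ ρ₀^{k-|I|}`; sum over the `(k choose t)` index sets of each size `t ≤ f`. Joint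
measurability of the container in `(Z|_I, z)` is `measurable_measure_prodMk_left` applied to a measurable subset of
`((I → Ω) × Ω) × Ω`.

References: D. Kleitman, K. Winston, Discrete Math. 41 (1982) 167–172; J. Balogh, R. Morris, W. Samotij, "The method of
hypergraph containers", Proc. ICM 2018, §2 (graph containers). The i.i.d.-sampling form above is the one the stick
large deviation consumes (with the binomial count, whose entropy `f log(ek/f)` is `o(k log(1/ρ₀))` there).
-/

namespace Summit.AtomisticToContinuum.HydrodynamicLimit.Theorems.DiffuseBackwardInfluenceShare

namespace Containers

open scoped BigOperators ENNReal Classical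
open Set MeasureTheory Filter

noncomputable section

variable {Ω : Type*} [MeasurableSpace Ω]

/-! ## §1 Containers of a configuration relative to an index set -/

/-- The COMPLEMENT OF THE SHADOWS of the sample points indexed by `I`: `C_I(Z) = {z | ∀ i ∈ I, ¬ Adj (Z i) z}`. -/
def avoidSet (Adj : Ω → Ω → Prop) {k : ℕ} (Z : Fin k → Ω) (I : Finset (Fin k)) : Set Ω :=
  {z | ∀ i ∈ I, ¬ Adj (Z i) z}

/-- The CONTAINER of index set `I`: the points of `C_I(Z)` whose `ν`-degree into `C_I(Z)` is `< d`. -/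
def cont (ν : Measure Ω) (Adj : Ω → Ω → Prop) (d : ℝ≥0∞) {k : ℕ} (Z : Fin k → Ω) (I : Finset (Fin k)) :
    Set Ω :=
  {z | z ∈ avoidSet Adj Z I ∧ ν ({z' | Adj z z'} ∩ avoidSet Adj Z I) < d}

/-- The same two sets as functions of the restricted configuration `a : I → Ω` (for the Fubini split). -/
def avoidSet' (Adj : Ω → Ω → Prop) {k : ℕ} {I : Finset (Fin k)} (a : {i // i ∈ I} → Ω) : Set Ω :=
  {z | ∀ i : {i // i ∈ I}, ¬ Adj (a i) z}

/-- The container as a function of the restricted configuration. -/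
def cont' (ν : Measure Ω) (Adj : Ω → Ω → Prop) (d : ℝ≥0∞) {k : ℕ} {I : Finset (Fin k)}
    (a : {i // i ∈ I} → Ω) : Set Ω :=
  {z | z ∈ avoidSet' Adj a ∧ ν ({z' | Adj z z'} ∩ avoidSet' Adj a) < d}

variable {Adj : Ω → Ω → Prop} {k : ℕ}

omit [MeasurableSpace Ω] in
/-- `C_I(Z)` depends on `Z` only through `Z|_I`. -/
theorem avoidSet_eq_avoidSet' (Z : Fin k → Ω) (I : Finset (Fin k)) :
    avoidSet Adj Z I = avoidSet' Adj (fun i : {i // i ∈ I} => Z i) := by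
  ext z
  simp only [avoidSet, avoidSet', mem_setOf_eq, Subtype.forall]

/-- The container depends on `Z` only through `Z|_I`. -/
theorem cont_eq_cont' (ν : Measure Ω) (d : ℝ≥0∞) (Z : Fin k → Ω) (I : Finset (Fin k)) :
    cont ν Adj d Z I = cont' ν Adj d (fun i : {i // i ∈ I} => Z i) := by
  ext z
  simp only [cont, cont', mem_setOf_eq, avoidSet_eq_avoidSet']

/-- Shadows are measurable (sections of the measurable graph). -/
theorem measurableSet_shadow (hAdj : MeasurableSet {p : Ω × Ω | Adj p.1 p.2}) (z : Ω) :
    MeasurableSet {z' | Adj z z'} :=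
  measurable_prodMk_left hAdj

/-- `C_I(Z)` is measurable. -/
theorem measurableSet_avoidSet (hAdj : MeasurableSet {p : Ω × Ω | Adj p.1 p.2}) (Z : Fin k → Ω)
    (I : Finset (Fin k)) : MeasurableSet (avoidSet Adj Z I) := by
  have : avoidSet Adj Z I = ⋂ i ∈ I, {z | Adj (Z i) z}ᶜ := by
    ext z; simp [avoidSet]
  rw [this]
  exact MeasurableSet.biInter (Set.to_countable _) fun i _ => (measurableSet_shadow hAdj (Z i)).compl

omit [MeasurableSpace Ω] in
/-- Inserting an index removes one more shadow: `C_{I ∪ {j}} = C_I \ shadow(Z j)`. -/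
theorem avoidSet_insert (Z : Fin k → Ω) (I : Finset (Fin k)) (j : Fin k) :
    avoidSet Adj Z (insert j I) = avoidSet Adj Z I \ {z | Adj (Z j) z} := by
  ext z
  simp only [avoidSet, Finset.mem_insert, forall_eq_or_imp, mem_setOf_eq, Set.mem_sdiff]
  tauto

/-! ## §2 Joint measurability of the container, and SMALL CONTAINERS from supersaturation -/

section Measurability

variable (ν : Measure Ω) [SFinite ν] (hAdj : MeasurableSet {p : Ω × Ω | Adj p.1 p.2}) (d : ℝ≥0∞)
  (I : Finset (Fin k))

include hAdj

/-- The graph `{(a, z) | z ∈ cont'(a)}` of the container is a measurable subset of `(I → Ω) × Ω`. -/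
theorem measurableSet_graph_cont' :
    MeasurableSet {q : ({i // i ∈ I} → Ω) × Ω | q.2 ∈ cont' ν Adj d q.1} := by
  -- the avoid part
  have hA : MeasurableSet {q : ({i // i ∈ I} → Ω) × Ω | ∀ i, ¬ Adj (q.1 i) q.2} := by
    have : {q : ({i // i ∈ I} → Ω) × Ω | ∀ i, ¬ Adj (q.1 i) q.2} =
        ⋂ i, (fun q : ({i // i ∈ I} → Ω) × Ω => (q.1 i, q.2)) ⁻¹' {p : Ω × Ω | Adj p.1 p.2}ᶜ := by
      ext q; simp
    rw [this]
    exact MeasurableSet.iInter fun i =>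
      ((measurable_pi_apply i).comp measurable_fst).prodMk measurable_snd hAdj.compl
  -- the degree part: (a, z) ↦ ν {z' | Adj z z' ∧ ∀ i, ¬ Adj (a i) z'} is measurable
  set T : Set ((({i // i ∈ I} → Ω) × Ω) × Ω) :=
    {w | Adj w.1.2 w.2 ∧ ∀ i, ¬ Adj (w.1.1 i) w.2} with hT
  have hTm : MeasurableSet T := by
    have h1 : MeasurableSet {w : (({i // i ∈ I} → Ω) × Ω) × Ω | Adj w.1.2 w.2} :=
      (measurable_snd.comp measurable_fst).prodMk measurable_snd hAdj
    have h2 : MeasurableSet {w : (({i // i ∈ I} → Ω) × Ω) × Ω | ∀ i, ¬ Adj (w.1.1 i) w.2} := by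
      have : {w : (({i // i ∈ I} → Ω) × Ω) × Ω | ∀ i, ¬ Adj (w.1.1 i) w.2} =
          ⋂ i, (fun w : (({i // i ∈ I} → Ω) × Ω) × Ω => (w.1.1 i, w.2)) ⁻¹' {p : Ω × Ω | Adj p.1 p.2}ᶜ := by
        ext w; simp
      rw [this]
      exact MeasurableSet.iInter fun i =>
        (((measurable_pi_apply i).comp measurable_fst).comp measurable_fst).prodMk measurable_snd hAdj.compl
    simpa only [hT, setOf_and] using h1.inter h2
  have hdeg : Measurable fun q : ({i // i ∈ I} → Ω) × Ω => ν (Prod.mk q ⁻¹' T) :=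
    measurable_measure_prodMk_left hTm
  have hsec : ∀ q : ({i // i ∈ I} → Ω) × Ω,
      Prod.mk q ⁻¹' T = {z' | Adj q.2 z'} ∩ avoidSet' Adj q.1 := by
    intro q; ext z'; simp [hT, avoidSet']
  have hD : MeasurableSet {q : ({i // i ∈ I} → Ω) × Ω | ν ({z' | Adj q.2 z'} ∩ avoidSet' Adj q.1) < d} := by
    have : {q : ({i // i ∈ I} → Ω) × Ω | ν ({z' | Adj q.2 z'} ∩ avoidSet' Adj q.1) < d} =
        (fun q => ν (Prod.mk q ⁻¹' T)) ⁻¹' Iio d := by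
      ext q; simp [hsec q]
    rw [this]
    exact hdeg measurableSet_Iio
  have heq : {q : ({i // i ∈ I} → Ω) × Ω | q.2 ∈ cont' ν Adj d q.1} =
      {q | ∀ i, ¬ Adj (q.1 i) q.2} ∩ {q | ν ({z' | Adj q.2 z'} ∩ avoidSet' Adj q.1) < d} := by
    ext q; simp [cont', avoidSet']
  rw [heq]
  exact hA.inter hD

/-- Each container `cont'(a)` is measurable. -/
theorem measurableSet_cont' (a : {i // i ∈ I} → Ω) : MeasurableSet (cont' ν Adj d a) :=
  measurable_prodMk_left (m := inferInstance) (measurableSet_graph_cont' ν hAdj d I)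

end Measurability

/-- **Small containers.** Under SUPERSATURATION at `(ρ₀, 2d)` — every measurable `S` with `ν S ≥ ρ₀` has
`∫_S ν(shadow z ∩ S) dν ≥ 2 d ν S` — every container has measure `≤ ρ₀`: all its points have degree `< d` into the
larger set `C_I`, so its internal average degree is `≤ d < 2d`. -/
theorem measure_cont'_le (ν : Measure Ω) [IsProbabilityMeasure ν]
    (hAdj : MeasurableSet {p : Ω × Ω | Adj p.1 p.2}) {d ρ₀ : ℝ≥0∞} (hd : 0 < d) (hdtop : d ≠ ∞) (hρ₀ : 0 < ρ₀)
    (hsat : ∀ S : Set Ω, MeasurableSet S → ρ₀ ≤ ν S →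
      2 * d * ν S ≤ ∫⁻ z in S, ν ({z' | Adj z z'} ∩ S) ∂ν)
    (I : Finset (Fin k)) (a : {i // i ∈ I} → Ω) : ν (cont' ν Adj d a) ≤ ρ₀ := by
  by_contra hlt
  have hge : ρ₀ ≤ ν (cont' ν Adj d a) := (not_le.1 hlt).le
  have hSm : MeasurableSet (cont' ν Adj d a) := measurableSet_cont' ν hAdj d I a
  have hsub : cont' ν Adj d a ⊆ avoidSet' Adj a := fun z hz => hz.1
  -- internal degrees are < d
  have hint : ∫⁻ z in cont' ν Adj d a, ν ({z' | Adj z z'} ∩ cont' ν Adj d a) ∂ν ≤ d * ν (cont' ν Adj d a) := by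
    calc ∫⁻ z in cont' ν Adj d a, ν ({z' | Adj z z'} ∩ cont' ν Adj d a) ∂ν
        ≤ ∫⁻ _z in cont' ν Adj d a, d ∂ν := by
          refine setLIntegral_mono measurable_const fun z hz => ?_
          exact (measure_mono (inter_subset_inter_right _ hsub)).trans hz.2.le
      _ = d * ν (cont' ν Adj d a) := setLIntegral_const _ _
  have h2 := (hsat _ hSm hge).trans hint
  have hm0 : ν (cont' ν Adj d a) ≠ 0 := (hρ₀.trans_le hge).ne'
  have hmtop : ν (cont' ν Adj d a) ≠ ∞ := measure_ne_top _ _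
  have hprod0 : d * ν (cont' ν Adj d a) ≠ 0 := mul_ne_zero hd.ne' hm0
  have hprodtop : d * ν (cont' ν Adj d a) ≠ ∞ := ENNReal.mul_ne_top hdtop hmtop
  rw [mul_assoc, two_mul] at h2
  have h0 : d * ν (cont' ν Adj d a) ≤ 0 := by
    have h2' : d * ν (cont' ν Adj d a) + d * ν (cont' ν Adj d a) ≤ d * ν (cont' ν Adj d a) + 0 := by
      rwa [add_zero]
    exact (ENNReal.add_le_add_iff_left hprodtop).1 h2'
  exact hprod0 (nonpos_iff_eq_zero.1 h0)

/-! ## §3 The COVER: a pairwise non-adjacent configuration has a small fingerprint -/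

/-- **Cover lemma.** If `Z` is pairwise non-adjacent then some index set `I` with `|I| · d ≤ 1` has every other
sample point inside its container: take `I` of maximum size subject to the budget `ν(C_I) + |I| d ≤ 1`. -/
theorem exists_fingerprint (ν : Measure Ω) [IsProbabilityMeasure ν]
    (hAdj : MeasurableSet {p : Ω × Ω | Adj p.1 p.2}) (d : ℝ≥0∞) {Z : Fin k → Ω}
    (hZ : ∀ i j, i ≠ j → ¬ Adj (Z i) (Z j)) :
    ∃ I : Finset (Fin k), (I.card : ℝ≥0∞) * d ≤ 1 ∧ ∀ j ∉ I, Z j ∈ cont ν Adj d Z I := by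
  -- admissible index sets
  set adm : Finset (Finset (Fin k)) :=
    Finset.univ.filter fun I => ν (avoidSet Adj Z I) + (I.card : ℝ≥0∞) * d ≤ 1 with hadm
  have hne : adm.Nonempty := by
    refine ⟨∅, Finset.mem_filter.2 ⟨Finset.mem_univ _, ?_⟩⟩
    simp only [Finset.card_empty, Nat.cast_zero, zero_mul, add_zero]
    exact prob_le_one
  obtain ⟨I, hI, hmax⟩ := adm.exists_max_image Finset.card hne
  have hIadm : ν (avoidSet Adj Z I) + (I.card : ℝ≥0∞) * d ≤ 1 := (Finset.mem_filter.1 hI).2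
  refine ⟨I, le_trans le_add_self hIadm, fun j hj => ?_⟩
  have hjC : Z j ∈ avoidSet Adj Z I := fun i hi => hZ i j (fun h => hj (h ▸ hi))
  refine ⟨hjC, ?_⟩
  by_contra hdeg
  have hdeg' : d ≤ ν ({z' | Adj (Z j) z'} ∩ avoidSet Adj Z I) := not_lt.1 hdeg
  -- then `insert j I` is admissible and larger
  have hins : ν (avoidSet Adj Z (insert j I)) + ((insert j I).card : ℝ≥0∞) * d ≤ 1 := by
    rw [avoidSet_insert, Finset.card_insert_of_notMem hj]
    have hsplit := measure_inter_add_sdiff (μ := ν) (avoidSet Adj Z I) (measurableSet_shadow hAdj (Z j))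
    -- ν (C ∩ shadow) + ν (C \ shadow) = ν C
    push_cast
    rw [add_mul, one_mul]
    calc ν (avoidSet Adj Z I \ {z' | Adj (Z j) z'}) + ((I.card : ℝ≥0∞) * d + d)
        = (d + ν (avoidSet Adj Z I \ {z' | Adj (Z j) z'})) + (I.card : ℝ≥0∞) * d := by ring
      _ ≤ (ν ({z' | Adj (Z j) z'} ∩ avoidSet Adj Z I) + ν (avoidSet Adj Z I \ {z' | Adj (Z j) z'})) +
            (I.card : ℝ≥0∞) * d := by gcongr
      _ = ν (avoidSet Adj Z I) + (I.card : ℝ≥0∞) * d := by rw [inter_comm, hsplit]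
      _ ≤ 1 := hIadm
  have hmem : insert j I ∈ adm := Finset.mem_filter.2 ⟨Finset.mem_univ _, hins⟩
  have hcard := hmax _ hmem
  rw [Finset.card_insert_of_notMem hj] at hcard
  omega

/-! ## §4 Counting: the union bound over fingerprints -/

/-- The event "every sample point outside `I` lies in the container of `I`". -/
def fingerprintEvent (ν : Measure Ω) (Adj : Ω → Ω → Prop) (d : ℝ≥0∞) (k : ℕ) (I : Finset (Fin k)) :
    Set (Fin k → Ω) :=
  {Z | ∀ j ∉ I, Z j ∈ cont ν Adj d Z I}

/-- **One fingerprint.** If all containers have measure `≤ ρ₀` then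
`ν^{⊗k} {Z | ∀ j ∉ I, Z j ∈ cont_I(Z)} ≤ ρ₀^{k - |I|}` (split the product measure along `I`). -/
theorem pi_fingerprintEvent_le (ν : Measure Ω) [IsProbabilityMeasure ν]
    (hAdj : MeasurableSet {p : Ω × Ω | Adj p.1 p.2}) (d : ℝ≥0∞) {ρ₀ : ℝ≥0∞}
    (I : Finset (Fin k)) (hcont : ∀ a : {i // i ∈ I} → Ω, ν (cont' ν Adj d a) ≤ ρ₀) :
    Measure.pi (fun _ : Fin k => ν) (fingerprintEvent ν Adj d k I) ≤ ρ₀ ^ (k - I.card) := by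
  set p : Fin k → Prop := fun i => i ∈ I with hp
  have hmp := measurePreserving_piEquivPiSubtypeProd (fun _ : Fin k => ν) p
  set e := MeasurableEquiv.piEquivPiSubtypeProd (fun _ : Fin k => Ω) p with he
  -- the image event
  set F : Set (({i // p i} → Ω) × ({i // ¬ p i} → Ω)) :=
    {q | ∀ j : {i // ¬ p i}, q.2 j ∈ cont' ν Adj d q.1} with hF
  have hpre : fingerprintEvent ν Adj d k I = e ⁻¹' F := by
    ext Z
    simp only [fingerprintEvent, mem_setOf_eq, mem_preimage, hF, cont_eq_cont', Subtype.forall, hp]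
    constructor
    · intro h j hj
      simpa [he, MeasurableEquiv.piEquivPiSubtypeProd] using h j hj
    · intro h j hj
      simpa [he, MeasurableEquiv.piEquivPiSubtypeProd] using h j hj
  have hFm : MeasurableSet F := by
    have : F = ⋂ j : {i // ¬ p i},
        (fun q : ({i // p i} → Ω) × ({i // ¬ p i} → Ω) => (q.1, q.2 j)) ⁻¹'
          {q : ({i // p i} → Ω) × Ω | q.2 ∈ cont' ν Adj d q.1} := by
      ext q; simp [hF]
    rw [this]
    exact MeasurableSet.iInter fun j =>
      (measurable_fst.prodMk ((measurable_pi_apply j).comp measurable_snd))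
        (measurableSet_graph_cont' ν hAdj d I)
  rw [hpre, hmp.measure_preimage hFm.nullMeasurableSet, Measure.prod_apply hFm]
  have hsec : ∀ a : {i // p i} → Ω, Prod.mk a ⁻¹' F = Set.pi univ fun _ : {i // ¬ p i} => cont' ν Adj d a := by
    intro a; ext b; simp [hF]
  have hcard : Fintype.card {i // ¬ p i} = k - I.card := by
    rw [Fintype.card_subtype_compl, Fintype.card_fin, Fintype.card_subtype]
    simp [hp]
  refine le_trans (lintegral_mono (g := fun _ => ρ₀ ^ (k - I.card)) fun a => ?_) ?_
  · show (Measure.pi fun _ : {i // ¬ p i} => ν) (Prod.mk a ⁻¹' F) ≤ ρ₀ ^ (k - I.card)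
    rw [hsec a, Measure.pi_pi, Finset.prod_const, Finset.card_univ, hcard]
    exact pow_le_pow_left₀ bot_le (hcont a) _
  · rw [lintegral_const, measure_univ, mul_one]

/-- **THE CONTAINER BOUND FOR I.I.D. SAMPLES** (registered sub-goal of the crux item, support of `stub_stickLD`). Let
`ν` be a probability measure, `Adj` a relation with measurable graph, `0 < d < ∞`, `0 < ρ₀`, and assume SUPERSATURATION:
every measurable `S` with `ρ₀ ≤ ν S` has `2 d ν S ≤ ∫_S ν({z' | Adj z z'} ∩ S) dν`. Then for all `k` and all `f : ℕ`
with `d⁻¹ ≤ f`, the `ν^{⊗k}`-probability that `k` i.i.d. samples are pairwise non-adjacent is at most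
`∑_{t=0}^{f} (k choose t) ρ₀^{k-t}`. -/
theorem pi_setOf_pairwise_not_adj_le : ∀ {Ω : Type} [MeasurableSpace Ω] (ν : Measure Ω) [IsProbabilityMeasure ν] (Adj : Ω → Ω → Prop), MeasurableSet {p : Ω × Ω | Adj p.1 p.2} → ∀ (d ρ₀ : ℝ≥0∞), 0 < d → d ≠ ⊤ → 0 < ρ₀ → (∀ S : Set Ω, MeasurableSet S → ρ₀ ≤ ν S → 2 * d * ν S ≤ ∫⁻ z in S, ν ({z' | Adj z z'} ∩ S) ∂ν) → ∀ (k f : ℕ), d⁻¹ ≤ (f : ℝ≥0∞) → Measure.pi (fun _ : Fin k => ν) {Z : Fin k → Ω | ∀ i j, i ≠ j → ¬ Adj (Z i) (Z j)} ≤ ∑ t ∈ Finset.range (f + 1), ((k.choose t : ℕ) : ℝ≥0∞) * ρ₀ ^ (k - t) := by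
  intro Ω _ ν _ Adj hAdj d ρ₀ hd hdtop hρ₀ hsat k f hf
  have hcont : ∀ (I : Finset (Fin k)) (a : {i // i ∈ I} → Ω), ν (cont' ν Adj d a) ≤ ρ₀ :=
    fun I a => measure_cont'_le ν hAdj hd hdtop hρ₀ hsat I a
  -- cover by fingerprint events of index sets of size ≤ f
  have hcover : {Z : Fin k → Ω | ∀ i j, i ≠ j → ¬ Adj (Z i) (Z j)} ⊆
      ⋃ t ∈ Finset.range (f + 1), ⋃ I ∈ Finset.powersetCard t (Finset.univ : Finset (Fin k)),
        fingerprintEvent ν Adj d k I := by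
    intro Z hZ
    obtain ⟨I, hIcard, hI⟩ := exists_fingerprint ν hAdj d hZ
    have hle : I.card ≤ f := by
      have h1 : (I.card : ℝ≥0∞) ≤ d⁻¹ := ENNReal.le_inv_iff_mul_le.2 hIcard
      exact_mod_cast h1.trans hf
    simp only [mem_iUnion, Finset.mem_range, Finset.mem_powersetCard, exists_prop]
    exact ⟨I.card, Nat.lt_succ_of_le hle, I, ⟨Finset.subset_univ _, rfl⟩, hI⟩
  calc Measure.pi (fun _ : Fin k => ν) {Z : Fin k → Ω | ∀ i j, i ≠ j → ¬ Adj (Z i) (Z j)}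
      ≤ Measure.pi (fun _ : Fin k => ν) (⋃ t ∈ Finset.range (f + 1),
          ⋃ I ∈ Finset.powersetCard t (Finset.univ : Finset (Fin k)), fingerprintEvent ν Adj d k I) :=
        measure_mono hcover
    _ ≤ ∑ t ∈ Finset.range (f + 1), Measure.pi (fun _ : Fin k => ν)
          (⋃ I ∈ Finset.powersetCard t (Finset.univ : Finset (Fin k)), fingerprintEvent ν Adj d k I) :=
        measure_biUnion_finset_le _ _
    _ ≤ ∑ t ∈ Finset.range (f + 1), ∑ I ∈ Finset.powersetCard t (Finset.univ : Finset (Fin k)),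
          Measure.pi (fun _ : Fin k => ν) (fingerprintEvent ν Adj d k I) :=
        Finset.sum_le_sum fun t _ => measure_biUnion_finset_le _ _
    _ ≤ ∑ t ∈ Finset.range (f + 1), ∑ I ∈ Finset.powersetCard t (Finset.univ : Finset (Fin k)),
          ρ₀ ^ (k - t) := by
        refine Finset.sum_le_sum fun t _ => Finset.sum_le_sum fun I hI => ?_
        have hIt : I.card = t := (Finset.mem_powersetCard.1 hI).2
        exact (pi_fingerprintEvent_le ν hAdj d I (hcont I)).trans_eq (by rw [hIt])
    _ = ∑ t ∈ Finset.range (f + 1), ((k.choose t : ℕ) : ℝ≥0∞) * ρ₀ ^ (k - t) := by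
        refine Finset.sum_congr rfl fun t _ => ?_
        rw [Finset.sum_const, Finset.card_powersetCard, Finset.card_univ, Fintype.card_fin, nsmul_eq_mul]

end

end Containers

end Summit.AtomisticToContinuum.HydrodynamicLimit.Theorems.DiffuseBackwardInfluenceShare
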